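/-
Copyright (c) 2026 the pub-hodgecm-mathlib formalisation cell (harness21).  Prover seat hodgecm-mathlib-K2E2-p06 (g0),
Track B «K2-LIT» ∕ h413 (stmt-HodgeConjecture-24833), line K2_E2 «ThetaExhaustionByRigidity», unit «CLASS-TRANSPORT», file #6:
payment of the socket `K2E2ThetaExhaustionByRigidity.ClassTransport.sig_K2E2TrHasFinComponentOfBijective` — `HasFinComponent`
PASSES ALONG AN EQUIVARIANT BIJECTION OF THE FINITE COMPONENT.  2026-09-03.
-/
import Literature.NumberTheory.Automorphic.UnitaryGroupCohomologicalForms   -- ★ `DiscreteAutomorphicRep.finRep`, `HasFinComponent`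
import HarnessLib

/-!
# K2_E2 road (h413 = stmt-HodgeConjecture-24833), unit «CLASS-TRANSPORT», file #6:
# `P.HasFinComponent σ` and a bijective intertwiner `σ → ρ` give `P.HasFinComponent ρ`

Cell `pub/hodgecm-mathlib` (D-0151), Track B (21-frontier RULING «PUSH BOTH» 2026-09-03, director req621∕req624, chair K2-lead,
dealer K2E2-plan), socket module
`Summits/HodgeConjecture/HodgeConjecture/Cruxes/H413/Lines/K2_E2_ThetaExhaustionByRigidity_ClassTransport.lean` (planner K2E2-plan (g0),
sha16 c1718b627d06a747), socket **`sig_K2E2TrHasFinComponentOfBijective`** (SIGS TABLE row #6, size S): for a discrete automorphic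
representation `P` of the unitary group `U(J)` (generic unitary datum `(F, E, c, N, J)`, ★ `UnitaryGroup.adelicGroupData`), two
representations `σ`, `ρ` of the finite-adelic group `U(J)(𝔸_{F,f})` (★ `UnitaryGroup.finAdelic`) and a BIJECTIVE intertwiner
`e : σ → ρ` (Mathlib `Representation.IntertwiningMap`): `P.HasFinComponent σ → P.HasFinComponent ρ`.

THE MATHEMATICS (pure representation theory; [BorelJacquet1979, §4.6] for the notion «`σ` occurs in `P|_{U(J)(𝔸_{F,f})}`», [Flath1979, §2]
for the finite component).  ★ `DiscreteAutomorphicRep.HasFinComponent P σ` is `∃ f : σ →[U(J)(𝔸_{F,f})] P.finRep, Function.Injective f`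
(★ `UnitaryGroupCohomologicalForms` §4).  A bijective intertwiner `e : σ → ρ` is an equivalence of representations (Mathlib
`Representation.IntertwiningMap.ofBijective`), its inverse `e⁻¹ : ρ → σ` is again an intertwiner (Mathlib `Representation.Equiv.symm`), and
`f ∘ e⁻¹ : ρ → P.finRep` (Mathlib `Representation.IntertwiningMap.comp`) is injective as a composite of injective maps.
* §1 `hasFinComponent_of_equiv` — the transport along a Mathlib `Representation.Equiv` (`σ.Equiv ρ`), and `hasFinComponent_congr`, the `↔` form;
* §2 **`trHasFinComponentOfBijective`** — `sig_K2E2TrHasFinComponentOfBijective` TOKEN FOR TOKEN (§1 at `e.ofBijective he`).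
CONSUMER RECIPE (closer #8 `K2E2TrFinComponentTransport`, tier 0's `stub_finComponentTransport`): with `f : σ ↪ ω_H(μ,a,χ)` injective and
bijective by #5 (`sig_K2E2TrBijectiveOfInjective`), `trHasFinComponentOfBijective μA P σ (rhoAtLine …) f hbij hσ : P.HasFinComponent (rhoAtLine …)`.
No hypothesis is idle: without bijectivity of `e` the statement is false in general (`e = 0 : σ → ρ` is an intertwiner for any `ρ`, and
not every `ρ` occurs in `P`); the conclusion is the honest ★ predicate, not a restatement.

HONEST LABEL: HC_CM is proved only modulo the 7 printed citations (2 remaining named inputs: hLiu418 = stmt-HodgeConjecture-24832,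
h413 = stmt-HodgeConjecture-24833) until rung 0 closes; this file is a `--supports stmt-HodgeConjecture-24833` helper (scaffold of the
K2_E2 road, consumed BY NAME by the closer #8 `K2E2TrFinComponentTransport`) and retires nothing by itself.

## References
* [BorelJacquet1979] A. Borel, H. Jacquet, *Automorphic forms and automorphic representations*, Proc. Sympos. Pure Math. 33.1 (1979),
  §4.6 (`π ≅ π_∞ ⊗ π_f`; the finite component of a discrete automorphic representation).
* [Flath1979] D. Flath, *Decomposition of representations into tensor products*, Proc. Sympos. Pure Math. 33.1 (1979), §2.
-/

set_option autoImplicit false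
-- the mandated namespace repeats the single-problem summit's segment (`HodgeConjecture.HodgeConjecture`)
set_option linter.dupNamespace false

noncomputable section

open NumberField MeasureTheory
open Literature.NumberTheory.Automorphic Literature.NumberTheory.Automorphic.UnitaryGroup

namespace Summit.HodgeConjecture.HodgeConjecture.Cruxes.H413.K2E2TrHasFinComponentOfBijective

variable {F E : Type} [Field F] [NumberField F] [Field E] [NumberField E] [Algebra F E] {c : E ≃ₐ[F] E} {N : ℕ}
  {J : Matrix (Fin N) (Fin N) E}
  {μ : Measure (adelicGroupData F E c N J).automorphicQuotient} [(adelicGroupData F E c N J).IsAutomorphicMeasure μ]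

/-! ## §1  Transport of `HasFinComponent` along an equivalence of representations of `U(J)(𝔸_{F,f})` -/

/-- **`P.HasFinComponent` is transported along an equivalence `φ : σ ≃ ρ` of representations of `U(J)(𝔸_{F,f})`**: compose the
injective intertwiner `f : σ → P.finRep` with the inverse intertwiner `φ.symm : ρ → σ` (Mathlib `Representation.Equiv.symm`,
`Representation.IntertwiningMap.comp`); the composite is injective. [cite: BorelJacquet1979, §4.6] [cite: Flath1979, §2] -/
theorem hasFinComponent_of_equiv (P : DiscreteAutomorphicRep (adelicGroupData F E c N J) μ)
    {V W : Type} [AddCommGroup V] [Module ℂ V] [AddCommGroup W] [Module ℂ W]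
    {σ : Representation ℂ (finAdelic F E c N J) V} {ρ : Representation ℂ (finAdelic F E c N J) W} (φ : σ.Equiv ρ)
    (h : P.HasFinComponent σ) : P.HasFinComponent ρ := by
  obtain ⟨f, hf⟩ := h
  exact ⟨f.comp φ.symm.toIntertwiningMap, hf.comp (EquivLike.injective φ.symm)⟩

/-- **`P.HasFinComponent σ ↔ P.HasFinComponent ρ` for equivalent representations `σ ≃ ρ` of `U(J)(𝔸_{F,f})`** (§1 applied to `φ` and
to `φ.symm`). [cite: BorelJacquet1979, §4.6] [cite: Flath1979, §2] -/
theorem hasFinComponent_congr (P : DiscreteAutomorphicRep (adelicGroupData F E c N J) μ)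
    {V W : Type} [AddCommGroup V] [Module ℂ V] [AddCommGroup W] [Module ℂ W]
    {σ : Representation ℂ (finAdelic F E c N J) V} {ρ : Representation ℂ (finAdelic F E c N J) W} (φ : σ.Equiv ρ) :
    P.HasFinComponent σ ↔ P.HasFinComponent ρ :=
  ⟨hasFinComponent_of_equiv P φ, hasFinComponent_of_equiv P φ.symm⟩

/-! ## §2  The head: `sig_K2E2TrHasFinComponentOfBijective` token for token -/

/-- **PAYMENT OF `sig_K2E2TrHasFinComponentOfBijective`** (socket #6 of unit «CLASS-TRANSPORT» of the K2_E2 road,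
`Cruxes/H413/Lines/K2_E2_ThetaExhaustionByRigidity_ClassTransport.lean`, TOKEN FOR TOKEN).
**`HasFinComponent` passes along an equivariant BIJECTION of the finite component.**  If `σ` is a finite component of the discrete
automorphic `P` of `U(J)` (an injective `U(J)(𝔸_{F,f})`-intertwiner `σ → P.finRep`, ★ `DiscreteAutomorphicRep.HasFinComponent`) and
`e : σ → ρ` is a bijective intertwiner, then `ρ` is a finite component of `P`: a bijective intertwiner is an equivalence of
representations (Mathlib `Representation.IntertwiningMap.ofBijective`), and §1 composes with its inverse.
[cite: BorelJacquet1979, §4.6] [cite: Flath1979, §2] -/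
theorem trHasFinComponentOfBijective :
    ∀ {F E : Type} [Field F] [NumberField F] [Field E] [NumberField E] [Algebra F E] {c : E ≃ₐ[F] E} {N : ℕ}
      {J : Matrix (Fin N) (Fin N) E} (μ : Measure (adelicGroupData F E c N J).automorphicQuotient)
      [(adelicGroupData F E c N J).IsAutomorphicMeasure μ]
      (P : DiscreteAutomorphicRep (adelicGroupData F E c N J) μ)
      {V W : Type} [AddCommGroup V] [Module ℂ V] [AddCommGroup W] [Module ℂ W]
      (σ : Representation ℂ (finAdelic F E c N J) V) (ρ : Representation ℂ (finAdelic F E c N J) W) (e : σ.IntertwiningMap ρ),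
      Function.Bijective e → P.HasFinComponent σ → P.HasFinComponent ρ := by
  intro F E _ _ _ _ _ c N J μ _ P V W _ _ _ _ σ ρ e he hσ
  exact hasFinComponent_of_equiv P (e.ofBijective he) hσ

end Summit.HodgeConjecture.HodgeConjecture.Cruxes.H413.K2E2TrHasFinComponentOfBijective

end
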